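import Literature.Topology.FourManifolds.LatticeFormsSpecialOrthogonalSignatureZeroPerfect
import HarnessLib

/-!
# The orders of the abelianisations: `|SO⁺(L)^{ab}| = 1`, `|O⁺(L)^{ab}| = 2`, `|O(L)^{ab}| = 4` for every `L ≅ U^{⊕n}`, `n ≥ 3`
# (Gritsenko–Hulek–Sankaran, *J. Algebra* 322 (2009), Prop. 1.6, Thm. 1.7, p. 4; Markman, *JEMS* (2023) §5.1 for `V ≅ U^{⊕4}`)

Trunk T-4MAN vocabulary. Rows g50-#2/#3 identified the commutator words of `SO⁺`, `O⁺`, `O` for `L ≅ U^{⊕n}` (`n ≥ 3`) and cut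
the cosets of `[O, O] = SO⁺` out by `(χ, det)`. Here the three abelianisations are COUNTED: the classes of `G` under
"`φψ⁻¹` is a word in commutators of elements of `G`" (the cosets of `[G, G]`, i.e. the elements of `G^{ab}`) number `1`, `2`, `4`
for `G = SO⁺(L)`, `O⁺(L)`, `O(L)` — "`S̃O⁺(L)^{ab}` is trivial and `Õ⁺(L)^{ab} ≅ ℤ/2ℤ`" (Prop. 1.6 / Thm. 1.7) and
"`O(L_{2d})^{ab} ≅ (ℤ/2ℤ)^{ρ(d)+2}`" (p. 4; here `O(q_L) = 1`, `ρ = 0`), resp. Markman's "`Hom(O(V), ℂ*) ≅ ℤ/2ℤ × ℤ/2ℤ`". §1 is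
generic (any symmetric non-degenerate lattice satisfying the conclusions of rows g50-#2/#3); §2 the standard model `hyperbolicSum n`;
§3 every `L ≅ U^{⊕n}` and the genus `II_{n,n}`. Written for lane `lit-hodgefound` (Track 2 foundations; prover seat
`lit-hodgefound-p18`, gen 50, row g50-#6). THEOREMS ONLY — no definition, no named fact, no instance, no notation.

## Sources, verbatim

* GHS 2009 (held `paper:arxiv-0810.1614`) p. 4: "**Proposition 1.6** Let `L = 2U ⊕ L₁` be an even unimodular lattice of rank at
  least `6`. Then `S̃O⁺(L)^{ab}` is trivial and `Õ⁺(L)^{ab} ≅ ℤ/2ℤ`." "**Theorem 1.7** […] `S̃O⁺(L)^{ab}` is trivial and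
  `Õ⁺(L)^{ab} ≅ ℤ/2ℤ`." "`[O(L_{2d}), O(L_{2d})] = S̃O⁺(L_{2d})` and `O(L_{2d})^{ab} ≅ (ℤ/2ℤ)^{ρ(d)+2}`."
* Markman 2023 (held `paper:arxiv-1805.11574`) §5.1 p. 14: "The character group `Hom(O(V), ℂ*)` of `O(V)` is isomorphic to
  `ℤ/2ℤ × ℤ/2ℤ` and is generated by the determinant character `det` and the orientation character `ort`."

## Contents (all proved); "`α ∈ SO⁺`" = `α ∈ O⁺ ∧ det α = 1`; `[α,β] = ((β⁻¹·α⁻¹)·β)·α`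

* §1 generic counts: `Nat.card (Quot r) = Nat.card Y` for a relation `r` classified by a surjection (`natCard_quot_eq_of_forall_iff`);
  `|O/[O,O]| = 4` from the `(χ, det)` criterion and two witnesses, `|O⁺/[O⁺,O⁺]| = 2` from `[O⁺,O⁺] = SO⁺` and one witness,
  `|SO⁺/[SO⁺,SO⁺]| = 1` from `[SO⁺,SO⁺] = SO⁺`.
* §2 `hyperbolicSum n`, `n ≥ 3`: `hyperbolicSum_natCard_quot_commutators_eq_four`,
  `hyperbolicSum_natCard_quot_isOrientationPreserving_commutators_eq_two`, `hyperbolicSum_natCard_quot_specialOrthogonal_commutators_eq_one`.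
* §3 every `L ≅ U^{⊕n}` (`…_of_isometryEquiv_hyperbolicSum`) and every even unimodular `L` of rank `2n`, signature `0`
  (`…_of_isUnimodular_of_isEven`), `n ≥ 3`.
-/

noncomputable section

open Module
open LinearMap (BilinForm)
open LinearMap.BilinForm
open LinearMap.BilinForm (IsometryEquiv)

namespace Literature.Topology.FourManifolds

universe u

/-! ### §1 Generic counts -/

section Generic

/-- A relation classified by a surjection has as many classes as the target: if `r a b ⟺ f a = f b` and `f` is onto `Y`, then
`Nat.card (Quot r) = Nat.card Y`. [cite: GritsenkoHulekSankaran2009, Cor. 1.8 (characters separate the abelianisation)] -/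
theorem natCard_quot_eq_of_forall_iff {X Y : Type*} (r : X → X → Prop) (f : X → Y) (hf : ∀ a b, r a b ↔ f a = f b)
    (hsurj : Function.Surjective f) : Nat.card (Quot r) = Nat.card Y :=
  Nat.card_eq_of_bijective (Quot.lift f fun a b h ↦ (hf a b).1 h)
    ⟨by rintro ⟨a⟩ ⟨b⟩ h; exact Quot.sound ((hf a b).2 h), fun y ↦ by obtain ⟨x, rfl⟩ := hsurj y; exact ⟨Quot.mk r x, rfl⟩⟩

variable {L : Type u} [AddCommGroup L] [Module.Finite ℤ L] [Module.Free ℤ L] {Q : BilinForm ℤ L}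

/-- **`|O(L) / [O(L), O(L)]| = 4`** when the cosets of the commutator words are cut out by `(χ, det)` and `L` has an
orientation-preserving and an orientation-reversing isometry of determinant `−1` (then all four values of `(χ, det)` occur).
[cite: GritsenkoHulekSankaran2009, Cor. 1.8 and p. 4 ("O(L_{2d})^{ab} ≅ (ℤ/2ℤ)^{ρ(d)+2}")] [cite: Markman2023GeneralizedKummers, §5.1] -/
theorem natCard_quot_commutators_eq_four_of_forall_iff (hQ : Q.IsSymm) (hnd : Q.Nondegenerate)
    (H : ∀ φ ρ : Q.IsometryEquiv Q,
      IsWordIn {ψ | ∃ α β : Q.IsometryEquiv Q, ψ = ((β.symm.trans α.symm).trans β).trans α} (φ.trans ρ.symm) ↔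
        (φ.IsOrientationPreserving ↔ ρ.IsOrientationPreserving) ∧
          LinearMap.det (φ : L →ₗ[ℤ] L) = LinearMap.det (ρ : L →ₗ[ℤ] L))
    (hσ : ∃ σ : Q.IsometryEquiv Q, σ.IsOrientationPreserving ∧ LinearMap.det (σ : L →ₗ[ℤ] L) = -1)
    (hτ : ∃ τ : Q.IsometryEquiv Q, ¬ τ.IsOrientationPreserving ∧ LinearMap.det (τ : L →ₗ[ℤ] L) = -1) :
    Nat.card (Quot fun φ ρ : Q.IsometryEquiv Q ↦
      IsWordIn {ψ | ∃ α β : Q.IsometryEquiv Q, ψ = ((β.symm.trans α.symm).trans β).trans α} (φ.trans ρ.symm)) = 4 := by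
  classical
  obtain ⟨σ, hσO, hσd⟩ := hσ
  obtain ⟨τ, hτO, hτd⟩ := hτ
  have hστO : ¬ (σ.trans τ).IsOrientationPreserving := by
    rw [LinearMap.BilinForm.IsometryEquiv.isOrientationPreserving_trans_iff hQ hnd]
    exact fun h ↦ hτO (h.2 hσO)
  have hστd : LinearMap.det ((σ.trans τ : Q.IsometryEquiv Q) : L →ₗ[ℤ] L) = 1 := by
    rw [IsometryEquiv.det_trans_eq_mul, hσd, hτd]
    norm_num
  have h1O : (LinearMap.BilinForm.IsometryEquiv.refl Q).IsOrientationPreserving :=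
    LinearMap.BilinForm.IsometryEquiv.IsOrientationPreserving.refl
  have h1d : LinearMap.det ((LinearMap.BilinForm.IsometryEquiv.refl Q : Q.IsometryEquiv Q) : L →ₗ[ℤ] L) = 1 :=
    specialOrthogonal_refl.2
  rw [show (4 : ℕ) = Nat.card (Bool × Bool) by simp]
  refine natCard_quot_eq_of_forall_iff _
    (fun φ ↦ (decide φ.IsOrientationPreserving, decide (LinearMap.det (φ : L →ₗ[ℤ] L) = 1))) (fun a b ↦ ?_) ?_
  · rw [H, Prod.mk.injEq, decide_eq_decide, decide_eq_decide]
    rcases LinearMap.BilinForm.IsometryEquiv.det_eq_one_or_eq_neg_one a with ha | ha <;>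
      rcases LinearMap.BilinForm.IsometryEquiv.det_eq_one_or_eq_neg_one b with hb | hb <;>
      simp [ha, hb]
  · rintro ⟨b₁, b₂⟩
    cases b₁ <;> cases b₂
    · exact ⟨τ, by simp [hτO, hτd]⟩
    · exact ⟨σ.trans τ, by simp [hστO, hστd]⟩
    · exact ⟨σ, by simp [hσO, hσd]⟩
    · exact ⟨LinearMap.BilinForm.IsometryEquiv.refl Q, by simp [h1O, h1d]⟩

/-- **`|O⁺(L) / [O⁺(L), O⁺(L)]| = 2`** when the commutator words of `O⁺(L)` are exactly `SO⁺(L)` and `L` has an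
orientation-preserving isometry of determinant `−1`. [cite: GritsenkoHulekSankaran2009, Thm. 1.7 and Prop. 1.6 ("Õ⁺(L)^{ab} ≅ ℤ/2ℤ")] -/
theorem natCard_quot_isOrientationPreserving_commutators_eq_two_of_forall_iff (hQ : Q.IsSymm) (hnd : Q.Nondegenerate)
    (H : ∀ φ : Q.IsometryEquiv Q, IsWordIn {ψ | ∃ α β : Q.IsometryEquiv Q, α.IsOrientationPreserving ∧ β.IsOrientationPreserving ∧
        ψ = ((β.symm.trans α.symm).trans β).trans α} φ ↔ φ.IsOrientationPreserving ∧ LinearMap.det (φ : L →ₗ[ℤ] L) = 1)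
    (hσ : ∃ σ : Q.IsometryEquiv Q, σ.IsOrientationPreserving ∧ LinearMap.det (σ : L →ₗ[ℤ] L) = -1) :
    Nat.card (Quot fun φ ρ : {φ : Q.IsometryEquiv Q // φ.IsOrientationPreserving} ↦
      IsWordIn {ψ | ∃ α β : Q.IsometryEquiv Q, α.IsOrientationPreserving ∧ β.IsOrientationPreserving ∧
        ψ = ((β.symm.trans α.symm).trans β).trans α} (φ.1.trans ρ.1.symm)) = 2 := by
  classical
  obtain ⟨σ, hσO, hσd⟩ := hσ
  have h1d : LinearMap.det ((LinearMap.BilinForm.IsometryEquiv.refl Q : Q.IsometryEquiv Q) : L →ₗ[ℤ] L) = 1 :=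
    specialOrthogonal_refl.2
  rw [show (2 : ℕ) = Nat.card Bool by simp]
  refine natCard_quot_eq_of_forall_iff _ (fun φ ↦ decide (LinearMap.det (φ.1 : L →ₗ[ℤ] L) = 1)) (fun a b ↦ ?_) ?_
  · have hab : (a.1.trans b.1.symm).IsOrientationPreserving :=
      (LinearMap.BilinForm.IsometryEquiv.isOrientationPreserving_trans_iff hQ hnd a.1 b.1.symm).2
        (iff_of_true ((LinearMap.BilinForm.IsometryEquiv.isOrientationPreserving_symm_iff hQ hnd b.1).2 b.2) a.2)
    rw [H, decide_eq_decide, IsometryEquiv.det_trans_eq_mul, IsometryEquiv.det_symm_eq]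
    rcases LinearMap.BilinForm.IsometryEquiv.det_eq_one_or_eq_neg_one a.1 with ha | ha <;>
      rcases LinearMap.BilinForm.IsometryEquiv.det_eq_one_or_eq_neg_one b.1 with hb | hb <;>
      simp [ha, hb, hab]
  · rintro (_ | _)
    · exact ⟨⟨σ, hσO⟩, by simp [hσd]⟩
    · exact ⟨⟨LinearMap.BilinForm.IsometryEquiv.refl Q, LinearMap.BilinForm.IsometryEquiv.IsOrientationPreserving.refl⟩,
        by simp [h1d]⟩

/-- **`|SO⁺(L) / [SO⁺(L), SO⁺(L)]| = 1`** when the commutator words of `SO⁺(L)` are exactly `SO⁺(L)` (`SO⁺(L)` perfect).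
[cite: GritsenkoHulekSankaran2009, Thm. 1.7 and Prop. 1.6 ("S̃O⁺(L)^{ab} is trivial")] -/
theorem natCard_quot_specialOrthogonal_commutators_eq_one_of_forall_iff (hQ : Q.IsSymm) (hnd : Q.Nondegenerate)
    (H : ∀ φ : Q.IsometryEquiv Q, IsWordIn {ψ | ∃ α β : Q.IsometryEquiv Q,
        (α.IsOrientationPreserving ∧ LinearMap.det (α : L →ₗ[ℤ] L) = 1) ∧ (β.IsOrientationPreserving ∧
          LinearMap.det (β : L →ₗ[ℤ] L) = 1) ∧ ψ = ((β.symm.trans α.symm).trans β).trans α} φ ↔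
        φ.IsOrientationPreserving ∧ LinearMap.det (φ : L →ₗ[ℤ] L) = 1) :
    Nat.card (Quot fun φ ρ : {φ : Q.IsometryEquiv Q // φ.IsOrientationPreserving ∧ LinearMap.det (φ : L →ₗ[ℤ] L) = 1} ↦
      IsWordIn {ψ | ∃ α β : Q.IsometryEquiv Q, (α.IsOrientationPreserving ∧ LinearMap.det (α : L →ₗ[ℤ] L) = 1) ∧
        (β.IsOrientationPreserving ∧ LinearMap.det (β : L →ₗ[ℤ] L) = 1) ∧ ψ = ((β.symm.trans α.symm).trans β).trans α}
        (φ.1.trans ρ.1.symm)) = 1 := by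
  rw [show (1 : ℕ) = Nat.card Unit by simp]
  refine natCard_quot_eq_of_forall_iff _ (fun _ ↦ ()) (fun a b ↦ iff_of_true ?_ rfl) fun _ ↦
    ⟨⟨LinearMap.BilinForm.IsometryEquiv.refl Q, specialOrthogonal_refl⟩, rfl⟩
  rw [H]
  exact specialOrthogonal_trans hQ hnd _ _ a.2 (specialOrthogonal_symm hQ hnd _ b.2)

end Generic

/-! ### §2 The standard model `U^{⊕n}`, `n ≥ 3` -/

section HyperbolicSum

/-- **`|O(U^{⊕n})^{ab}| = 4`, `n ≥ 3`** (`O(U^{⊕n})^{ab} ≅ (ℤ/2ℤ)²`): the cosets of `[O, O] = SO⁺(U^{⊕n})` in `O(U^{⊕n})` number four.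
[cite: GritsenkoHulekSankaran2009, p. 4 ("O(L_{2d})^{ab} ≅ (ℤ/2ℤ)^{ρ(d)+2}") and Cor. 1.8] [cite: Markman2023GeneralizedKummers, §5.1] -/
theorem hyperbolicSum_natCard_quot_commutators_eq_four {n : ℕ} (hn : 3 ≤ n) :
    Nat.card (Quot fun φ ρ : (hyperbolicSum n).IsometryEquiv (hyperbolicSum n) ↦
      IsWordIn {ψ | ∃ α β : (hyperbolicSum n).IsometryEquiv (hyperbolicSum n), ψ = ((β.symm.trans α.symm).trans β).trans α}
        (φ.trans ρ.symm)) = 4 := by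
  obtain ⟨hO, hd, hO', hd', -⟩ := hyperbolicSum_reflections_invariants (n := n) ⟨0, by omega⟩
  exact natCard_quot_commutators_eq_four_of_forall_iff (isSymm_hyperbolicSum n) (isUnimodular_hyperbolicSum n).nondegenerate
    (hyperbolicSum_isWordIn_commutators_trans_symm_iff hn) ⟨_, hO, hd⟩ ⟨_, hO', hd'⟩

/-- **`|O⁺(U^{⊕n})^{ab}| = 2`, `n ≥ 3`** (Thm. 1.7 (ii) `Õ⁺(L)^{ab} ≅ ℤ/2ℤ` for `L = U^{⊕n}`): the cosets of `[O⁺, O⁺] = SO⁺` in `O⁺` number two.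
[cite: GritsenkoHulekSankaran2009, Thm. 1.7 and Prop. 1.6] -/
theorem hyperbolicSum_natCard_quot_isOrientationPreserving_commutators_eq_two {n : ℕ} (hn : 3 ≤ n) :
    Nat.card (Quot fun φ ρ : {φ : (hyperbolicSum n).IsometryEquiv (hyperbolicSum n) // φ.IsOrientationPreserving} ↦
      IsWordIn {ψ | ∃ α β : (hyperbolicSum n).IsometryEquiv (hyperbolicSum n), α.IsOrientationPreserving ∧
        β.IsOrientationPreserving ∧ ψ = ((β.symm.trans α.symm).trans β).trans α} (φ.1.trans ρ.1.symm)) = 2 := by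
  obtain ⟨hO, hd, -⟩ := hyperbolicSum_reflections_invariants (n := n) ⟨0, by omega⟩
  exact natCard_quot_isOrientationPreserving_commutators_eq_two_of_forall_iff (isSymm_hyperbolicSum n)
    (isUnimodular_hyperbolicSum n).nondegenerate (hyperbolicSum_isWordIn_commutators_of_isOrientationPreserving_iff hn) ⟨_, hO, hd⟩

/-- **`|SO⁺(U^{⊕n})^{ab}| = 1`, `n ≥ 3`** (Thm. 1.7 (i) "`S̃O⁺(L)^{ab}` is trivial" for `L = U^{⊕n}`).
[cite: GritsenkoHulekSankaran2009, Thm. 1.7 and Prop. 1.6] -/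
theorem hyperbolicSum_natCard_quot_specialOrthogonal_commutators_eq_one {n : ℕ} (hn : 3 ≤ n) :
    Nat.card (Quot fun φ ρ : {φ : (hyperbolicSum n).IsometryEquiv (hyperbolicSum n) // φ.IsOrientationPreserving ∧
        LinearMap.det (φ : (Fin n → ℤ) × (Fin n → ℤ) →ₗ[ℤ] (Fin n → ℤ) × (Fin n → ℤ)) = 1} ↦
      IsWordIn {ψ | ∃ α β : (hyperbolicSum n).IsometryEquiv (hyperbolicSum n),
        (α.IsOrientationPreserving ∧ LinearMap.det (α : (Fin n → ℤ) × (Fin n → ℤ) →ₗ[ℤ] (Fin n → ℤ) × (Fin n → ℤ)) = 1) ∧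
        (β.IsOrientationPreserving ∧ LinearMap.det (β : (Fin n → ℤ) × (Fin n → ℤ) →ₗ[ℤ] (Fin n → ℤ) × (Fin n → ℤ)) = 1) ∧
        ψ = ((β.symm.trans α.symm).trans β).trans α} (φ.1.trans ρ.1.symm)) = 1 :=
  natCard_quot_specialOrthogonal_commutators_eq_one_of_forall_iff (isSymm_hyperbolicSum n)
    (isUnimodular_hyperbolicSum n).nondegenerate (hyperbolicSum_isWordIn_commutators_of_specialOrthogonal_iff hn)

end HyperbolicSum

/-! ### §3 Every lattice isometric to `U^{⊕n}` and the genus `II_{n,n}`, `n ≥ 3` -/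

section Model

variable {W' : Type} [AddCommGroup W'] [Module.Finite ℤ W'] [Module.Free ℤ W'] {B' : BilinForm ℤ W'}

/-- **`|O(L)^{ab}| = 4` for every `L ≅ U^{⊕n}`, `n ≥ 3`** ("`Hom(O(V), ℂ*) ≅ ℤ/2ℤ × ℤ/2ℤ`", `V ≅ U^{⊕4}`).
[cite: Markman2023GeneralizedKummers, §5.1] [cite: GritsenkoHulekSankaran2009, p. 4 and Cor. 1.8] -/
theorem natCard_quot_commutators_eq_four_of_isometryEquiv_hyperbolicSum {n : ℕ} (hn : 3 ≤ n) (hB' : B'.IsSymm)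
    (hnd' : B'.Nondegenerate) (e : (hyperbolicSum n).IsometryEquiv B') :
    Nat.card (Quot fun φ ρ : B'.IsometryEquiv B' ↦
      IsWordIn {ψ | ∃ α β : B'.IsometryEquiv B', ψ = ((β.symm.trans α.symm).trans β).trans α} (φ.trans ρ.symm)) = 4 := by
  obtain ⟨hσ, hτ, -⟩ := exists_isometryEquiv_invariants_of_isometryEquiv_hyperbolicSum (by omega) hB' hnd' e
  exact natCard_quot_commutators_eq_four_of_forall_iff hB' hnd'
    (isWordIn_commutators_trans_symm_iff_of_isometryEquiv_hyperbolicSum hn hB' hnd' e) hσ hτ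

/-- **`|O⁺(L)^{ab}| = 2` for every `L ≅ U^{⊕n}`, `n ≥ 3`** (`Õ⁺(L)^{ab} ≅ ℤ/2ℤ`). [cite: GritsenkoHulekSankaran2009, Thm. 1.7 and Prop. 1.6] -/
theorem natCard_quot_isOrientationPreserving_commutators_eq_two_of_isometryEquiv_hyperbolicSum {n : ℕ} (hn : 3 ≤ n)
    (hB' : B'.IsSymm) (hnd' : B'.Nondegenerate) (e : (hyperbolicSum n).IsometryEquiv B') :
    Nat.card (Quot fun φ ρ : {φ : B'.IsometryEquiv B' // φ.IsOrientationPreserving} ↦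
      IsWordIn {ψ | ∃ α β : B'.IsometryEquiv B', α.IsOrientationPreserving ∧ β.IsOrientationPreserving ∧
        ψ = ((β.symm.trans α.symm).trans β).trans α} (φ.1.trans ρ.1.symm)) = 2 := by
  obtain ⟨hσ, -⟩ := exists_isometryEquiv_invariants_of_isometryEquiv_hyperbolicSum (by omega) hB' hnd' e
  exact natCard_quot_isOrientationPreserving_commutators_eq_two_of_forall_iff hB' hnd'
    (isWordIn_commutators_of_isOrientationPreserving_iff_of_isometryEquiv_hyperbolicSum hn hB' hnd' e) hσ

/-- **`|SO⁺(L)^{ab}| = 1` for every `L ≅ U^{⊕n}`, `n ≥ 3`** (`S̃O⁺(L)^{ab}` trivial). [cite: GritsenkoHulekSankaran2009, Thm. 1.7 and Prop. 1.6] -/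
theorem natCard_quot_specialOrthogonal_commutators_eq_one_of_isometryEquiv_hyperbolicSum {n : ℕ} (hn : 3 ≤ n)
    (hB' : B'.IsSymm) (hnd' : B'.Nondegenerate) (e : (hyperbolicSum n).IsometryEquiv B') :
    Nat.card (Quot fun φ ρ : {φ : B'.IsometryEquiv B' // φ.IsOrientationPreserving ∧ LinearMap.det (φ : W' →ₗ[ℤ] W') = 1} ↦
      IsWordIn {ψ | ∃ α β : B'.IsometryEquiv B', (α.IsOrientationPreserving ∧ LinearMap.det (α : W' →ₗ[ℤ] W') = 1) ∧
        (β.IsOrientationPreserving ∧ LinearMap.det (β : W' →ₗ[ℤ] W') = 1) ∧ ψ = ((β.symm.trans α.symm).trans β).trans α}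
        (φ.1.trans ρ.1.symm)) = 1 :=
  natCard_quot_specialOrthogonal_commutators_eq_one_of_forall_iff hB' hnd'
    (isWordIn_commutators_of_specialOrthogonal_iff_of_isometryEquiv_hyperbolicSum hn hB' hnd' e)

variable {W : Type} [AddCommGroup W] [Module.Finite ℤ W] [Module.Free ℤ W] {B : BilinForm ℤ W}

/-- **Prop. 1.6 counted for the genus `II_{n,n}`, `n ≥ 3`: `|SO⁺^{ab}| = 1`, `|O⁺^{ab}| = 2`, `|O^{ab}| = 4`** for every even unimodular
lattice of rank `2n` and signature `0`. [cite: GritsenkoHulekSankaran2009, Prop. 1.6, Thm. 1.7 and p. 4] [cite: Huybrechts2016K3, Ch. 14 Cor. 1.3 (i)] -/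
theorem natCard_quot_commutators_of_isUnimodular_of_isEven (hB : B.IsSymm) (hU : B.IsUnimodular) (he : B.IsEven) {n : ℕ}
    (hn : 3 ≤ n) (hrank : finrank ℤ W = 2 * n) (hsig : B.signature = 0) :
    Nat.card (Quot fun φ ρ : {φ : B.IsometryEquiv B // φ.IsOrientationPreserving ∧ LinearMap.det (φ : W →ₗ[ℤ] W) = 1} ↦
      IsWordIn {ψ | ∃ α β : B.IsometryEquiv B, (α.IsOrientationPreserving ∧ LinearMap.det (α : W →ₗ[ℤ] W) = 1) ∧
        (β.IsOrientationPreserving ∧ LinearMap.det (β : W →ₗ[ℤ] W) = 1) ∧ ψ = ((β.symm.trans α.symm).trans β).trans α}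
        (φ.1.trans ρ.1.symm)) = 1 ∧
    Nat.card (Quot fun φ ρ : {φ : B.IsometryEquiv B // φ.IsOrientationPreserving} ↦
      IsWordIn {ψ | ∃ α β : B.IsometryEquiv B, α.IsOrientationPreserving ∧ β.IsOrientationPreserving ∧
        ψ = ((β.symm.trans α.symm).trans β).trans α} (φ.1.trans ρ.1.symm)) = 2 ∧
    Nat.card (Quot fun φ ρ : B.IsometryEquiv B ↦
      IsWordIn {ψ | ∃ α β : B.IsometryEquiv B, ψ = ((β.symm.trans α.symm).trans β).trans α} (φ.trans ρ.symm)) = 4 := by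
  obtain ⟨e⟩ := equivalent_hyperbolicSum_of_signature_eq_zero _ hB hU he (by omega) hrank hsig
  exact ⟨natCard_quot_specialOrthogonal_commutators_eq_one_of_isometryEquiv_hyperbolicSum hn hB hU.nondegenerate e.symm,
    natCard_quot_isOrientationPreserving_commutators_eq_two_of_isometryEquiv_hyperbolicSum hn hB hU.nondegenerate e.symm,
    natCard_quot_commutators_eq_four_of_isometryEquiv_hyperbolicSum hn hB hU.nondegenerate e.symm⟩

end Model

end Literature.Topology.FourManifolds

end
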